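import Summits.QuantumFields.BalabanUV.Beta.GAN24.SecondOrderInputsLinear

/-!
# `BalabanUV.Beta.GAN24.SocketLiteralTrace` — binder row G-an2-4 ∕ (CONV-C), routes C-R6° («VALUES») × R7 («TWO CURRENCIES»), PART 207:
# LITERAL TRACES ARE SOCKET VALUES — `tr(X_i·Y·X_j·Z) = (Γ₁(Y ⊗ₖ Zᵀ)Γ₂ᴴ)(i,j)` WITH `Γ₁` THE SWAPPED AND `Γ₂` THE CONJUGATED LEG FAMILY; the leg envelopes ∕ EL₃ are invariant
# under swap and conjugation; the two-kernel socket in INPUT-BUNDLE form (PART 206's currency, (EL) at ALL integer root pairs); the trace contraction's volume limit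
# with BOTH roots free (unit b2b-balaban-gan24-p3, gen 63; v1)

NOT IN PRINT; OUR PROOF ([folklore] finite sums and bookkeeping BY NAME over PART 203 (`decay_twoKernel_of_inputs_moving`), PART 150 (`tendsto_legs_pair`, `tendsto_sum_window_pair`,
`exp_neg_mul_l1_windowMap_sub_castT_le`), PART 153 (`exp_distK_le_exp_window_pair'`), PART 143 (`norm_le_of_entryDecay`), PART 141 (`sum_idx_eq_sum_site`); [Balaban1987RG1] (1.20)–(1.22)
p. 264 LOCATE the one-loop shapes; nothing printed is a hypothesis).
HONEST FRAMING (cell contract, verbatim): «discharging `BetaPertH` makes Bałaban's UV stability UNCONDITIONAL — a real constructive-QFT result; it is NOT the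
continuum limit and NOT the Clay problem.»  HONEST DEPENDENCY (verbatim): «continuum YM on T⁴ ⇐ BetaPertH ∧ nine spine estimates (0/9 proved); BetaPertH ⇐
(D1) ∧ (D4) ∧ CAP+tail; G-an2-4 gates asym, D1 and NE2/3/4.»

WHY (census V202′ (a)).  PARTs 196 ∕ 197 ∕ 200 ∕ 203 type the one-loop contraction as the SOCKET VALUE `(Γ₁(Y ⊗ₖ Z)Γ₂ᴴ)(i,j)` with both leg families equal to the insertion
words `X_{x,k}(q,r)`.  Row an1's coefficient is a LITERAL TRACE `tr(𝒢Σ_i𝒢Σ_j) ∝ tr(X_iYX_jY)`, `tr(𝒢Σ_{ij})`'s pieces `tr(X_ic⁻¹X_jY)`, `tr(X_iYX_jc⁻¹)`, and `X_i = 𝒢P_i𝒢` is NOT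
symmetric.  §1 records the exact placement making a literal trace a socket value: kernel `Y ⊗ₖ Zᵀ`, left legs SWAPPED (`Γ₁(x,(q,r)) = X_x(r,q)`), right legs CONJUGATED
(`Γ₂(x,(q,r)) = conj X_x(q,r)`) — NO symmetry or reality of any letter is used.  §2: the leg hypotheses of the sockets (level ∕ step envelopes `γe^{−κ(distK x q + distK x r)}`,
EL₃ at integer triples) are invariant under both operations, so PART 200's leg supply serves every placement.  §3: the two-kernel socket with its three INPUTS concluded
(PART 206's bundle, (EL) at all root pairs via PART 150's `tendsto_legs_pair`) rather than its END — so that signed combinations can be formed BEFORE PART 140.  §4: PART 205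
§2's pair-window Tannery with the second root free (the transpose of the second tadpole needs it).

WHAT THIS FILE PROVES (0 sorry, 0 `def`):
* §1 **`trace_mul₄_eq_socket_apply`**, **`traceKernel_eq_socket`** — `tr(X₁ᵢ·Y·X₂ⱼ·Z) = (Γ₁(Y ⊗ₖ Zᵀ)Γ₂ᴴ)(i,j)`, `Γ₁ = of (x,(q,r)) ↦ X₁ₓ(r,q)`, `Γ₂ = of (x,(q,r)) ↦ conj X₂ₓ(q,r)`
  (any index types; four-fold finite sum re-ordered).
* §2 `legs_swap_envelope ∕ _step ∕ _tendsto`, `legs_conj_envelope ∕ _step ∕ _tendsto` — the socket leg hypotheses under swap `(q,r) ↦ (r,q)` and entrywise conjugation.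
* §3 **`inputs_twoKernel_of_inputs_moving`** — (`d ≥ 2`, `side t → ∞`, `κ > 0`, `0 ≤ θ`) for two volume-indexed towers `Y, Z` with (UD) `(Bᵢ, κ)`, (SR) `(Bᵢ′, κ, θ)`, EL₂ at all
  integer pairs: `∃ C, C′ ≥ 0` such that for all legs with level ∕ step envelopes (rate `κ`, ratio `θ`) and EL₃: the socket tower `Γ_{1,t,k}(Y_{t,k} ⊗ₖ Z_{t,k})Γ_{2,t,k}ᴴ` has
  (UD) `(γ₁γ₂C, κ∕4)`, (SR) `((γ₁′γ₂ + γ₁γ₂′)C + γ₁γ₂C′, κ∕4, θ)` and (EL) at ALL integer root pairs — PART 206's input bundle.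
* §4 **`tendsto_traceContraction₂`** — `tr(Y_tW_t)` converges when `‖W_t(e(w₂,l₂),e(w₁,l₁))‖ ≤ B_W·e^{−κ|windowMap(w₂ − ẑ)|₁}·e^{−κ|windowMap(w₁ − ẑ′)|₁}` (two roots), `Y_t` bounded,
  both with EL₂.
WHAT IT DOES NOT DO: instantiate on the loop covariance ∕ insertion words (PART 208); choose signs (row an1); Bałaban's `Π⁰`.
SUPPLIER work; NEVER «G-an2-4 closed»; NOT (CONV-C), NOT D1, NOT `BetaPertH`, NOT continuum, NOT Clay.  Records: `HOME/b2b-balaban-gan24-p3/gen63/README.md`.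
-/

noncomputable section

open scoped BigOperators ComplexConjugate Matrix Matrix.Norms.L2Operator Kronecker
open Filter Topology Finset Matrix

namespace Summit.QuantumFields.BalabanUV.Beta.GAN24.SocketLiteralTrace

open Literature.MathematicalPhysics.QuantumFieldTheory.Balaban1983to89
open Literature.MathematicalPhysics.QuantumFieldTheory.Balaban1983to89.B5Prop11Plancherel (Tor fine)
open Literature.MathematicalPhysics.QuantumFieldTheory.Balaban1983to89.B12Sec2to5 (l1 summable_exp_neg_l1)
open Literature.MathematicalPhysics.QuantumFieldTheory.Balaban1983to89.Beta (Site windowMap)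
open Literature.MathematicalPhysics.QuantumFieldTheory.Balaban1983to89.Beta.FreeLegDictionary (cubic)
open Literature.MathematicalPhysics.QuantumFieldTheory.Balaban1983to89.Beta.VectorTails (castT)
open Summit.QuantumFields.BalabanUV.T4Continuum.BalabanAveragedTowerUnit (idx)
open Summit.QuantumFields.BalabanUV.T4Continuum.BalabanAveragedCoerciveTower (unitIdx)
open Summit.QuantumFields.BalabanUV.T4Continuum.CTKingTowerWeights (distK distK_comm)
open Summit.QuantumFields.BalabanUV.T4Continuum.DecayRateInterpolation (EntryDecay TwoLevelDecayRate)
open Summit.QuantumFields.BalabanUV.Beta.GAN24.UnitLatticeDecayAlgebra (distK_nonneg)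
open Summit.QuantumFields.BalabanUV.Beta.GAN24.DiagramVolumeLimitAlgebra (sum_idx_eq_sum_site)
open Summit.QuantumFields.BalabanUV.Beta.GAN24.DiagramVolumeLimitSandwich (norm_le_of_entryDecay)
open Summit.QuantumFields.BalabanUV.Beta.GAN24.DiagramVolumeLimitLegs (tendsto_legs_pair tendsto_sum_window_pair exp_neg_mul_l1_windowMap_sub_castT_le)
open Summit.QuantumFields.BalabanUV.Beta.GAN24.DiagramVolumeLimitOneLoop (exp_distK_le_exp_window_pair')
open Summit.QuantumFields.BalabanUV.Beta.GAN24.OneStepLoopContractionTwoKernels (decay_twoKernel_of_inputs_moving)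

variable {d : ℕ} (L : ℕ) [NeZero L]

/-! ## §1 A literal trace of four letters is a socket value -/

section Trace

variable {ι n : Type*} [Fintype n]

/-- **`trace_mul₄_eq_socket_apply` — `tr(X₁ᵢ·Y·X₂ⱼ·Z) = (Γ₁(Y ⊗ₖ Zᵀ)Γ₂ᴴ)(i,j)`** with the SWAPPED left legs `Γ₁(x,(q,r)) = X₁ₓ(r,q)` and the CONJUGATED right legs
`Γ₂(x,(q,r)) = conj X₂ₓ(q,r)`: both sides are `Σ_{a,b,c,e} X₁ᵢ(a,b)Y(b,c)X₂ⱼ(c,e)Z(e,a)`.  No symmetry ∕ reality of any letter is used. [folklore] -/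
theorem trace_mul₄_eq_socket_apply (X₁ X₂ : ι → Matrix n n ℂ) (Y Z : Matrix n n ℂ) (i j : ι) :
    (X₁ i * Y * X₂ j * Z).trace =
      ((Matrix.of fun (x : ι) (q : n × n) => X₁ x q.2 q.1) * (Y ⊗ₖ Zᵀ) * (Matrix.of fun (x : ι) (q : n × n) => star (X₂ x q.1 q.2))ᴴ) i j := by
  calc (X₁ i * Y * X₂ j * Z).trace = ∑ a, ∑ e, ∑ c, ∑ b, X₁ i a b * Y b c * X₂ j c e * Z e a := by
        simp only [Matrix.trace, Matrix.diag_apply, Matrix.mul_apply, Finset.sum_mul]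
    _ = ∑ e, ∑ a, ∑ c, ∑ b, X₁ i a b * Y b c * X₂ j c e * Z e a := Finset.sum_comm
    _ = ∑ e, ∑ c, ∑ a, ∑ b, X₁ i a b * Y b c * X₂ j c e * Z e a := Finset.sum_congr rfl fun _ _ => Finset.sum_comm
    _ = ∑ e, ∑ c, ∑ b, ∑ a, X₁ i a b * Y b c * X₂ j c e * Z e a := Finset.sum_congr rfl fun _ _ => Finset.sum_congr rfl fun _ _ => Finset.sum_comm
    _ = ∑ c, ∑ e, ∑ b, ∑ a, X₁ i a b * Y b c * X₂ j c e * Z e a := Finset.sum_comm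
    _ = _ := by
        simp only [Matrix.mul_apply, Finset.sum_mul, Matrix.conjTranspose_apply, Matrix.of_apply, star_star, Matrix.kroneckerMap_apply, Matrix.transpose_apply,
          Fintype.sum_prod_type]
        exact Finset.sum_congr rfl fun _ _ => Finset.sum_congr rfl fun _ _ => Finset.sum_congr rfl fun _ _ => Finset.sum_congr rfl fun _ _ => by ring

/-- **`traceKernel_eq_socket` — THE SAME AS A KERNEL IDENTITY**: `of (i,j) ↦ tr(X₁ᵢ·Y·X₂ⱼ·Z) = Γ₁(Y ⊗ₖ Zᵀ)Γ₂ᴴ`. [folklore] -/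
theorem traceKernel_eq_socket (X₁ X₂ : ι → Matrix n n ℂ) (Y Z : Matrix n n ℂ) :
    (Matrix.of fun i j => (X₁ i * Y * X₂ j * Z).trace) =
      (Matrix.of fun (x : ι) (q : n × n) => X₁ x q.2 q.1) * (Y ⊗ₖ Zᵀ) * (Matrix.of fun (x : ι) (q : n × n) => star (X₂ x q.1 q.2))ᴴ := by
  ext i j
  rw [Matrix.of_apply]
  exact trace_mul₄_eq_socket_apply X₁ X₂ Y Z i j

end Trace

/-! ## §2 The socket leg hypotheses under swap and conjugation -/

section Legs

variable {side : ℕ → ℕ}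

omit [NeZero L] in
/-- the level envelope under swap `(q,r) ↦ (r,q)` (the envelope is symmetric in `q, r`). [folklore] -/
theorem legs_swap_envelope {X : (t : ℕ) → idx L (cubic d (side t)) 0 → ℕ → Matrix (idx L (cubic d (side t)) 0) (idx L (cubic d (side t)) 0) ℂ} {γ κ : ℝ}
    (h : ∀ t k x q, ‖(Matrix.of fun (x : idx L (cubic d (side t)) 0) (q : idx L (cubic d (side t)) 0 × idx L (cubic d (side t)) 0) => X t x k q.1 q.2) x q‖
      ≤ γ * Real.exp (-(κ * (distK L (cubic d (side t)) x q.1 + distK L (cubic d (side t)) x q.2)))) :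
    ∀ t k x q, ‖(Matrix.of fun (x : idx L (cubic d (side t)) 0) (q : idx L (cubic d (side t)) 0 × idx L (cubic d (side t)) 0) => X t x k q.2 q.1) x q‖
      ≤ γ * Real.exp (-(κ * (distK L (cubic d (side t)) x q.1 + distK L (cubic d (side t)) x q.2))) := by
  intro t k x q
  have h' := h t k x (q.2, q.1)
  simp only [Matrix.of_apply] at h' ⊢
  rwa [add_comm] at h'

omit [NeZero L] in
/-- the step envelope under swap. [folklore] -/
theorem legs_swap_step {X : (t : ℕ) → idx L (cubic d (side t)) 0 → ℕ → Matrix (idx L (cubic d (side t)) 0) (idx L (cubic d (side t)) 0) ℂ} {γ κ θ : ℝ}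
    (h : ∀ t k x q, ‖((Matrix.of fun (x : idx L (cubic d (side t)) 0) (q : idx L (cubic d (side t)) 0 × idx L (cubic d (side t)) 0) => X t x (k + 1) q.1 q.2)
        - (Matrix.of fun (x : idx L (cubic d (side t)) 0) (q : idx L (cubic d (side t)) 0 × idx L (cubic d (side t)) 0) => X t x k q.1 q.2)) x q‖
      ≤ γ * θ ^ k * Real.exp (-(κ * (distK L (cubic d (side t)) x q.1 + distK L (cubic d (side t)) x q.2)))) :
    ∀ t k x q, ‖((Matrix.of fun (x : idx L (cubic d (side t)) 0) (q : idx L (cubic d (side t)) 0 × idx L (cubic d (side t)) 0) => X t x (k + 1) q.2 q.1)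
        - (Matrix.of fun (x : idx L (cubic d (side t)) 0) (q : idx L (cubic d (side t)) 0 × idx L (cubic d (side t)) 0) => X t x k q.2 q.1)) x q‖
      ≤ γ * θ ^ k * Real.exp (-(κ * (distK L (cubic d (side t)) x q.1 + distK L (cubic d (side t)) x q.2))) := by
  intro t k x q
  have h' := h t k x (q.2, q.1)
  simp only [Matrix.sub_apply, Matrix.of_apply] at h' ⊢
  rwa [add_comm (distK L (cubic d (side t)) x q.2)] at h'

omit [NeZero L] in
/-- EL₃ under swap (re-instantiate at the swapped triple). [folklore] -/
theorem legs_swap_tendsto [∀ t, NeZero (side t)] {X : (t : ℕ) → idx L (cubic d (side t)) 0 → ℕ → Matrix (idx L (cubic d (side t)) 0) (idx L (cubic d (side t)) 0) ℂ}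
    (h : ∀ k (μ' l l' : Fin d) (z u v : Fin d → ℤ), ∃ s' : ℂ, Tendsto (fun t => (Matrix.of fun (x : idx L (cubic d (side t)) 0) (q : idx L (cubic d (side t)) 0 × idx L (cubic d (side t)) 0) => X t x k q.1 q.2)
      ((unitIdx L (cubic d (side t))).symm (castT (cubic d (side t)) z, μ'))
      ((unitIdx L (cubic d (side t))).symm (castT (cubic d (side t)) u, l), (unitIdx L (cubic d (side t))).symm (castT (cubic d (side t)) v, l'))) atTop (𝓝 s')) :
    ∀ k (μ' l l' : Fin d) (z u v : Fin d → ℤ), ∃ s' : ℂ, Tendsto (fun t => (Matrix.of fun (x : idx L (cubic d (side t)) 0) (q : idx L (cubic d (side t)) 0 × idx L (cubic d (side t)) 0) => X t x k q.2 q.1)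
      ((unitIdx L (cubic d (side t))).symm (castT (cubic d (side t)) z, μ'))
      ((unitIdx L (cubic d (side t))).symm (castT (cubic d (side t)) u, l), (unitIdx L (cubic d (side t))).symm (castT (cubic d (side t)) v, l'))) atTop (𝓝 s') := by
  intro k μ' l l' z u v
  obtain ⟨s', hs'⟩ := h k μ' l' l z v u
  exact ⟨s', by simpa only [Matrix.of_apply] using hs'⟩

omit [NeZero L] in
/-- the level envelope under entrywise conjugation (`‖conj w‖ = ‖w‖`). [folklore] -/
theorem legs_conj_envelope {X : (t : ℕ) → idx L (cubic d (side t)) 0 → ℕ → Matrix (idx L (cubic d (side t)) 0) (idx L (cubic d (side t)) 0) ℂ} {γ κ : ℝ}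
    (h : ∀ t k x q, ‖(Matrix.of fun (x : idx L (cubic d (side t)) 0) (q : idx L (cubic d (side t)) 0 × idx L (cubic d (side t)) 0) => X t x k q.1 q.2) x q‖
      ≤ γ * Real.exp (-(κ * (distK L (cubic d (side t)) x q.1 + distK L (cubic d (side t)) x q.2)))) :
    ∀ t k x q, ‖(Matrix.of fun (x : idx L (cubic d (side t)) 0) (q : idx L (cubic d (side t)) 0 × idx L (cubic d (side t)) 0) => star (X t x k q.1 q.2)) x q‖
      ≤ γ * Real.exp (-(κ * (distK L (cubic d (side t)) x q.1 + distK L (cubic d (side t)) x q.2))) := by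
  intro t k x q
  have h' := h t k x q
  simp only [Matrix.of_apply] at h' ⊢
  rwa [norm_star]

omit [NeZero L] in
/-- the step envelope under entrywise conjugation. [folklore] -/
theorem legs_conj_step {X : (t : ℕ) → idx L (cubic d (side t)) 0 → ℕ → Matrix (idx L (cubic d (side t)) 0) (idx L (cubic d (side t)) 0) ℂ} {γ κ θ : ℝ}
    (h : ∀ t k x q, ‖((Matrix.of fun (x : idx L (cubic d (side t)) 0) (q : idx L (cubic d (side t)) 0 × idx L (cubic d (side t)) 0) => X t x (k + 1) q.1 q.2)
        - (Matrix.of fun (x : idx L (cubic d (side t)) 0) (q : idx L (cubic d (side t)) 0 × idx L (cubic d (side t)) 0) => X t x k q.1 q.2)) x q‖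
      ≤ γ * θ ^ k * Real.exp (-(κ * (distK L (cubic d (side t)) x q.1 + distK L (cubic d (side t)) x q.2)))) :
    ∀ t k x q, ‖((Matrix.of fun (x : idx L (cubic d (side t)) 0) (q : idx L (cubic d (side t)) 0 × idx L (cubic d (side t)) 0) => star (X t x (k + 1) q.1 q.2))
        - (Matrix.of fun (x : idx L (cubic d (side t)) 0) (q : idx L (cubic d (side t)) 0 × idx L (cubic d (side t)) 0) => star (X t x k q.1 q.2))) x q‖
      ≤ γ * θ ^ k * Real.exp (-(κ * (distK L (cubic d (side t)) x q.1 + distK L (cubic d (side t)) x q.2))) := by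
  intro t k x q
  have h' := h t k x q
  simp only [Matrix.sub_apply, Matrix.of_apply] at h' ⊢
  rwa [← star_sub, norm_star]

omit [NeZero L] in
/-- EL₃ under entrywise conjugation (`conj` is continuous). [folklore] -/
theorem legs_conj_tendsto [∀ t, NeZero (side t)] {X : (t : ℕ) → idx L (cubic d (side t)) 0 → ℕ → Matrix (idx L (cubic d (side t)) 0) (idx L (cubic d (side t)) 0) ℂ}
    (h : ∀ k (μ' l l' : Fin d) (z u v : Fin d → ℤ), ∃ s' : ℂ, Tendsto (fun t => (Matrix.of fun (x : idx L (cubic d (side t)) 0) (q : idx L (cubic d (side t)) 0 × idx L (cubic d (side t)) 0) => X t x k q.1 q.2)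
      ((unitIdx L (cubic d (side t))).symm (castT (cubic d (side t)) z, μ'))
      ((unitIdx L (cubic d (side t))).symm (castT (cubic d (side t)) u, l), (unitIdx L (cubic d (side t))).symm (castT (cubic d (side t)) v, l'))) atTop (𝓝 s')) :
    ∀ k (μ' l l' : Fin d) (z u v : Fin d → ℤ), ∃ s' : ℂ, Tendsto (fun t => (Matrix.of fun (x : idx L (cubic d (side t)) 0) (q : idx L (cubic d (side t)) 0 × idx L (cubic d (side t)) 0) => star (X t x k q.1 q.2))
      ((unitIdx L (cubic d (side t))).symm (castT (cubic d (side t)) z, μ'))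
      ((unitIdx L (cubic d (side t))).symm (castT (cubic d (side t)) u, l), (unitIdx L (cubic d (side t))).symm (castT (cubic d (side t)) v, l'))) atTop (𝓝 s') := by
  intro k μ' l l' z u v
  obtain ⟨s', hs'⟩ := h k μ' l l' z u v
  exact ⟨star s', by simpa only [Matrix.of_apply] using hs'.star⟩

end Legs

/-! ## §3 The two-kernel socket with moving legs, concluded as an INPUT BUNDLE ((EL) at all integer root pairs) -/

section Socket

variable {side : ℕ → ℕ} [∀ t, NeZero (side t)]

/-- **`inputs_twoKernel_of_inputs_moving` — THE TWO-KERNEL ONE-LOOP CONTRACTION WITH MOVING LEGS, CONCLUDED AS PART 206's INPUT BUNDLE** (`d ≥ 2`, `side t → ∞`, `κ > 0`,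
`θ ≥ 0`): for volume-indexed towers `Y_t, Z_t` with (UD) `(B₁, κ)`, `(B₂, κ)`, (SR) `(B₁′, κ, θ)`, `(B₂′, κ, θ)` and EL₂ at all integer pairs, `∃ C, C′ ≥ 0` such that for ALL
`γᵢ, γᵢ′ ≥ 0` and ALL legs with level envelope `γᵢe^{−κ(distK x q + distK x r)}`, step envelope `γᵢ′θ^k e^{−κ(…)}` and EL₃ at every level, the socket tower
`Γ_{1,t,k}(Y_{t,k} ⊗ₖ Z_{t,k})Γ_{2,t,k}ᴴ` has (UD) `(γ₁γ₂C, κ∕4)`, (SR) `((γ₁′γ₂ + γ₁γ₂′)C + γ₁γ₂C′, κ∕4, θ)` and (EL) at ALL integer root pairs — PART 203 §1 + PART 150's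
`tendsto_legs_pair` at `(ẑ, ẑ′)`. [cite: Balaban1987RG1, (1.21)–(1.22) p.264 (shapes)] [folklore] -/
theorem inputs_twoKernel_of_inputs_moving (hd : 2 ≤ d) (hside : Tendsto side atTop atTop)
    {Y Z : (t : ℕ) → ℕ → Matrix (idx L (cubic d (side t)) 0) (idx L (cubic d (side t)) 0) ℂ} {B₁ B₁' B₂ B₂' κ θ : ℝ}
    (hκ : 0 < κ) (hB₁ : 0 ≤ B₁) (hB₁' : 0 ≤ B₁') (hB₂ : 0 ≤ B₂) (hB₂' : 0 ≤ B₂') (hθ0 : 0 ≤ θ)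
    (hudY : ∀ t k, EntryDecay (distK L (cubic d (side t))) (Y t k) B₁ κ) (hsrY : ∀ t, TwoLevelDecayRate (distK L (cubic d (side t))) (Y t) B₁' κ θ)
    (hudZ : ∀ t k, EntryDecay (distK L (cubic d (side t))) (Z t k) B₂ κ) (hsrZ : ∀ t, TwoLevelDecayRate (distK L (cubic d (side t))) (Z t) B₂' κ θ)
    (helY : ∀ k (μ ν : Fin d) (z z' : Fin d → ℤ), ∃ s' : ℂ, Tendsto (fun t => Y t k ((unitIdx L (cubic d (side t))).symm (castT (cubic d (side t)) z, μ))
      ((unitIdx L (cubic d (side t))).symm (castT (cubic d (side t)) z', ν))) atTop (𝓝 s'))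
    (helZ : ∀ k (μ ν : Fin d) (z z' : Fin d → ℤ), ∃ s' : ℂ, Tendsto (fun t => Z t k ((unitIdx L (cubic d (side t))).symm (castT (cubic d (side t)) z, μ))
      ((unitIdx L (cubic d (side t))).symm (castT (cubic d (side t)) z', ν))) atTop (𝓝 s')) :
    ∃ C C' : ℝ, 0 ≤ C ∧ 0 ≤ C' ∧ ∀ (γ₁ γ₂ γ₁' γ₂' : ℝ), 0 ≤ γ₁ → 0 ≤ γ₂ → 0 ≤ γ₁' → 0 ≤ γ₂' →
      ∀ (Γ₁ Γ₂ : (t k : ℕ) → Matrix (idx L (cubic d (side t)) 0) (idx L (cubic d (side t)) 0 × idx L (cubic d (side t)) 0) ℂ),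
      (∀ t k x q, ‖Γ₁ t k x q‖ ≤ γ₁ * Real.exp (-(κ * (distK L (cubic d (side t)) x q.1 + distK L (cubic d (side t)) x q.2)))) →
      (∀ t k x q, ‖Γ₂ t k x q‖ ≤ γ₂ * Real.exp (-(κ * (distK L (cubic d (side t)) x q.1 + distK L (cubic d (side t)) x q.2)))) →
      (∀ t k x q, ‖(Γ₁ t (k + 1) - Γ₁ t k) x q‖ ≤ γ₁' * θ ^ k * Real.exp (-(κ * (distK L (cubic d (side t)) x q.1 + distK L (cubic d (side t)) x q.2)))) →
      (∀ t k x q, ‖(Γ₂ t (k + 1) - Γ₂ t k) x q‖ ≤ γ₂' * θ ^ k * Real.exp (-(κ * (distK L (cubic d (side t)) x q.1 + distK L (cubic d (side t)) x q.2)))) →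
      (∀ k (μ' l l' : Fin d) (z u v : Fin d → ℤ), ∃ s' : ℂ, Tendsto (fun t => Γ₁ t k ((unitIdx L (cubic d (side t))).symm (castT (cubic d (side t)) z, μ'))
        ((unitIdx L (cubic d (side t))).symm (castT (cubic d (side t)) u, l), (unitIdx L (cubic d (side t))).symm (castT (cubic d (side t)) v, l'))) atTop (𝓝 s')) →
      (∀ k (μ' l l' : Fin d) (z u v : Fin d → ℤ), ∃ s' : ℂ, Tendsto (fun t => Γ₂ t k ((unitIdx L (cubic d (side t))).symm (castT (cubic d (side t)) z, μ'))
        ((unitIdx L (cubic d (side t))).symm (castT (cubic d (side t)) u, l), (unitIdx L (cubic d (side t))).symm (castT (cubic d (side t)) v, l'))) atTop (𝓝 s')) →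
      (∀ t k, EntryDecay (distK L (cubic d (side t))) (Γ₁ t k * (Y t k ⊗ₖ Z t k) * (Γ₂ t k)ᴴ) (γ₁ * γ₂ * C) (κ / 4)) ∧
      (∀ t, TwoLevelDecayRate (distK L (cubic d (side t))) (fun k => Γ₁ t k * (Y t k ⊗ₖ Z t k) * (Γ₂ t k)ᴴ) (((γ₁' * γ₂ + γ₁ * γ₂') * C + γ₁ * γ₂ * C')) (κ / 4) θ) ∧
      (∀ k (μ ν : Fin d) (z z' : Fin d → ℤ), ∃ s' : ℂ, Tendsto (fun t => (Γ₁ t k * (Y t k ⊗ₖ Z t k) * (Γ₂ t k)ᴴ) ((unitIdx L (cubic d (side t))).symm (castT (cubic d (side t)) z, μ))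
        ((unitIdx L (cubic d (side t))).symm (castT (cubic d (side t)) z', ν))) atTop (𝓝 s')) := by
  have hd1 : 1 ≤ d := le_trans (by norm_num) hd
  have hd0 : (0 : ℝ) < d := by exact_mod_cast lt_of_lt_of_le zero_lt_one hd1
  obtain ⟨C, C', hC, hC', hmov⟩ := decay_twoKernel_of_inputs_moving L hd hκ hB₁ hB₁' hB₂ hB₂' hθ0
  refine ⟨C, C', hC, hC', fun γ₁ γ₂ γ₁' γ₂' hγ₁ hγ₂ hγ₁' hγ₂' Γ₁ Γ₂ hΓ₁ hΓ₂ hΓ₁' hΓ₂' hΓ₁el hΓ₂el => ⟨?_, ?_, ?_⟩⟩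
  · exact fun t => (hmov (cubic d (side t)) (Y t) (Z t) (hudY t) (hsrY t) (hudZ t) (hsrZ t) γ₁ γ₂ γ₁' γ₂' hγ₁ hγ₂ hγ₁' hγ₂' (Γ₁ t) (Γ₂ t) (hΓ₁ t) (hΓ₂ t) (hΓ₁' t) (hΓ₂' t)).1
  · exact fun t => (hmov (cubic d (side t)) (Y t) (Z t) (hudY t) (hsrY t) (hudZ t) (hsrZ t) γ₁ γ₂ γ₁' γ₂' hγ₁ hγ₂ hγ₁' hγ₂' (Γ₁ t) (Γ₂ t) (hΓ₁ t) (hΓ₂ t) (hΓ₁' t) (hΓ₂' t)).2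
  · -- the legs' window decay away from the root, rate `κ/d`, at one level
    have hwin : ∀ {γ : ℝ} (Γ : (t : ℕ) → Matrix (idx L (cubic d (side t)) 0) (idx L (cubic d (side t)) 0 × idx L (cubic d (side t)) 0) ℂ),
        (∀ t x q, ‖Γ t x q‖ ≤ γ * Real.exp (-(κ * (distK L (cubic d (side t)) x q.1 + distK L (cubic d (side t)) x q.2)))) → 0 ≤ γ →
        ∀ t (x : Beta.Site d (side t)) (μ' : Fin d) (u : Beta.Site d (side t)) (l : Fin d) (v : Beta.Site d (side t)) (l' : Fin d),
          ‖Γ t ((unitIdx L (cubic d (side t))).symm (x, μ')) ((unitIdx L (cubic d (side t))).symm (u, l), (unitIdx L (cubic d (side t))).symm (v, l'))‖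
            ≤ γ * (Real.exp (-(κ / d) * l1 (windowMap d (side t) (u - x))) * Real.exp (-(κ / d) * l1 (windowMap d (side t) (v - x)))) := by
      intro γ Γ hΓ hγ t x μ' u l v l'
      refine (hΓ t _ _).trans ?_
      rw [mul_add, neg_add, Real.exp_add]
      exact mul_le_mul_of_nonneg_left (mul_le_mul (exp_distK_le_exp_window_pair' L (side t) hκ.le x μ' u l)
        (exp_distK_le_exp_window_pair' L (side t) hκ.le x μ' v l') (Real.exp_pos _).le (Real.exp_pos _).le) hγ
    intro k μ' ν' z z'
    have hB12 : 0 ≤ max B₁ B₂ := le_max_of_le_left hB₁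
    have hYb : ∀ t (i j : idx L (cubic d (side t)) 0), ‖Y t k i j‖ ≤ max B₁ B₂ := fun t i j => (norm_le_of_entryDecay L (side t) hκ.le hB₁ (hudY t k) i j).trans (le_max_left _ _)
    have hZb : ∀ t (i j : idx L (cubic d (side t)) 0), ‖Z t k i j‖ ≤ max B₁ B₂ := fun t i j => (norm_le_of_entryDecay L (side t) hκ.le hB₂ (hudZ t k) i j).trans (le_max_right _ _)
    exact tendsto_legs_pair L (side := side) hside hB12 hYb hZb (hwin (fun t => Γ₁ t k) (fun t => hΓ₁ t k) hγ₁) (hwin (fun t => Γ₂ t k) (fun t => hΓ₂ t k) hγ₂)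
      (div_pos hκ hd0) (fun μ₁ ν₁ w w' => helY k μ₁ ν₁ w w') (fun μ₁ ν₁ w w' => helZ k μ₁ ν₁ w w') (hΓ₁el k) (hΓ₂el k) μ' ν' z z'

end Socket

/-! ## §4 The trace contraction's volume limit with both roots free -/

section Volume

variable {side : ℕ → ℕ} [∀ t, NeZero (side t)]

/-- **`tendsto_traceContraction₂` — THE TRACE CONTRACTION CONVERGES ALONG `side t → ∞`, TWO ROOTS** [our proof]: `Y_t` volume-uniformly bounded (`‖Y_t(q,r)‖ ≤ B_Y`) with EL₂,
and `W_t` with the window majorant `‖W_t(e(w₂,l₂), e(w₁,l₁))‖ ≤ B_W·e^{−κ|windowMap(w₂ − ẑ)|₁}·e^{−κ|windowMap(w₁ − ẑ′)|₁}` (`κ > 0`; decay about the roots `ẑ` and `ẑ′`) with EL₂ ⟹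
`tr(Y_tW_t) = Σ_{q,r} Y_t(q,r)W_t(r,q)` converges — PART 150's `tendsto_sum_window_pair` with the product majorant `(d·B_YB_W·e^{3κ|z′|₁}e^{−κ|y₁|₁})·(e^{3κ|z|₁}e^{−κ|y₂|₁})`
(both roots shifted home).  PART 205 §2 is the case `z′ = 0`. -/
theorem tendsto_traceContraction₂ (hside : Tendsto side atTop atTop)
    {Y W : (t : ℕ) → Matrix (idx L (cubic d (side t)) 0) (idx L (cubic d (side t)) 0) ℂ} {BY BW κ : ℝ} (hBY : 0 ≤ BY) (hBW : 0 ≤ BW) (hκ : 0 < κ)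
    (hYb : ∀ t q r, ‖Y t q r‖ ≤ BY) (z z' : Fin d → ℤ)
    (hWb : ∀ t (w₁ : Site d (side t)) (l₁ : Fin d) (w₂ : Site d (side t)) (l₂ : Fin d),
      ‖W t ((unitIdx L (cubic d (side t))).symm (w₂, l₂)) ((unitIdx L (cubic d (side t))).symm (w₁, l₁))‖
        ≤ BW * (Real.exp (-κ * l1 (windowMap d (side t) (w₂ - castT (cubic d (side t)) z))) * Real.exp (-κ * l1 (windowMap d (side t) (w₁ - castT (cubic d (side t)) z')))))
    (hYel : ∀ (l l' : Fin d) (u v : Fin d → ℤ), ∃ s' : ℂ, Tendsto (fun t => Y t ((unitIdx L (cubic d (side t))).symm (castT (cubic d (side t)) u, l))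
      ((unitIdx L (cubic d (side t))).symm (castT (cubic d (side t)) v, l'))) atTop (𝓝 s'))
    (hWel : ∀ (l l' : Fin d) (u v : Fin d → ℤ), ∃ s' : ℂ, Tendsto (fun t => W t ((unitIdx L (cubic d (side t))).symm (castT (cubic d (side t)) u, l))
      ((unitIdx L (cubic d (side t))).symm (castT (cubic d (side t)) v, l'))) atTop (𝓝 s')) :
    ∃ s' : ℂ, Tendsto (fun t => (Y t * W t).trace) atTop (𝓝 s') := by
  choose P hP using hYel
  choose R hR using hWel
  refine ⟨∑ l₁, ∑' y₁, ∑' y₂, ∑ l₂, P l₁ l₂ y₁ y₂ * R l₂ l₁ y₂ y₁, ?_⟩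
  have e : ∀ t, (Y t * W t).trace = ∑ l₁ : Fin d, ∑ w₁ : Site d (side t), ∑ w₂ : Site d (side t), ∑ l₂ : Fin d,
      Y t ((unitIdx L (cubic d (side t))).symm (w₁, l₁)) ((unitIdx L (cubic d (side t))).symm (w₂, l₂))
        * W t ((unitIdx L (cubic d (side t))).symm (w₂, l₂)) ((unitIdx L (cubic d (side t))).symm (w₁, l₁)) := by
    intro t
    simp only [Matrix.trace, Matrix.diag_apply, Matrix.mul_apply]
    rw [sum_idx_eq_sum_site]
    refine Finset.sum_congr rfl fun l₁ _ => Finset.sum_congr rfl fun w₁ _ => ?_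
    rw [sum_idx_eq_sum_site, Finset.sum_comm]
  simp only [e]
  refine tendsto_finsetSum _ fun l₁ _ => ?_
  refine tendsto_sum_window_pair hside
    (F := fun t w₁ w₂ => ∑ l₂ : Fin d,
      Y t ((unitIdx L (cubic d (side t))).symm (w₁, l₁)) ((unitIdx L (cubic d (side t))).symm (w₂, l₂))
        * W t ((unitIdx L (cubic d (side t))).symm (w₂, l₂)) ((unitIdx L (cubic d (side t))).symm (w₁, l₁)))
    (fun y₁ y₂ => tendsto_finsetSum _ fun l₂ _ => (hP l₁ l₂ y₁ y₂).mul (hR l₂ l₁ y₂ y₁))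
    (b₁ := fun y => d * (BY * BW) * Real.exp (3 * κ * l1 z') * Real.exp (-κ * l1 y)) (b₂ := fun y => Real.exp (3 * κ * l1 z) * Real.exp (-κ * l1 y))
    ((summable_exp_neg_l1 hκ d).mul_left _) ((summable_exp_neg_l1 hκ d).mul_left _) (fun y => by positivity) (fun y => by positivity) fun t w₁ w₂ => ?_
  calc ‖∑ l₂ : Fin d, Y t _ _ * W t _ _‖
      ≤ ∑ _l₂ : Fin d, BY * BW * ((Real.exp (3 * κ * l1 z') * Real.exp (-κ * l1 (windowMap d (side t) w₁))) * (Real.exp (3 * κ * l1 z) * Real.exp (-κ * l1 (windowMap d (side t) w₂)))) := by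
        refine norm_sum_le_of_le _ fun l₂ _ => ?_
        rw [norm_mul]
        have h1 := hYb t ((unitIdx L (cubic d (side t))).symm (w₁, l₁)) ((unitIdx L (cubic d (side t))).symm (w₂, l₂))
        have h3 := hWb t w₁ l₁ w₂ l₂
        have h5 := exp_neg_mul_l1_windowMap_sub_castT_le (side t) hκ.le w₂ z
        have h6 := exp_neg_mul_l1_windowMap_sub_castT_le (side t) hκ.le w₁ z'
        calc ‖Y t _ _‖ * ‖W t _ _‖
            ≤ BY * (BW * (Real.exp (-κ * l1 (windowMap d (side t) (w₂ - castT (cubic d (side t)) z))) * Real.exp (-κ * l1 (windowMap d (side t) (w₁ - castT (cubic d (side t)) z'))))) :=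
              mul_le_mul h1 h3 (norm_nonneg _) hBY
          _ ≤ BY * (BW * ((Real.exp (3 * κ * l1 z) * Real.exp (-κ * l1 (windowMap d (side t) w₂))) * (Real.exp (3 * κ * l1 z') * Real.exp (-κ * l1 (windowMap d (side t) w₁))))) := by
              gcongr
          _ = _ := by ring
    _ = (d * (BY * BW) * Real.exp (3 * κ * l1 z') * Real.exp (-κ * l1 (windowMap d (side t) w₁))) * (Real.exp (3 * κ * l1 z) * Real.exp (-κ * l1 (windowMap d (side t) w₂))) := by
        rw [Finset.sum_const, Finset.card_univ, Fintype.card_fin, nsmul_eq_mul]; ring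

end Volume

end Summit.QuantumFields.BalabanUV.Beta.GAN24.SocketLiteralTrace

end
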